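import Mathlib.MeasureTheory.Measure.Lebesgue.VolumeOfBalls
import Mathlib.MeasureTheory.Measure.Haar.InnerProductSpace
import Mathlib.LinearAlgebra.Determinant
import HarnessLib

/-!
# Integer points `z ∈ ℤ²` with `L z + b` in a disc: `≥ π (ρ − r)² / |det L|`

HONEST FRAMING. Part of the venture `Summits/Ventures/Crystal3D` (cell `crystal3d-full`).
Elementary geometry of numbers, generalising `TriangularDiscCount.lean` (`L = (u v)`, `det = √3/2`)
and `SquareDiscCount.lean` (`L = 1`); nothing about packings.

**Theorem** (`affine_disc_count`). Let `L` be the linear map of `ℝ²` with matrix `A`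
(`det A ≠ 0`), `b, c ∈ ℝ²`, and let `r ≥ 0` bound `‖A f‖` (Euclidean) over the unit square
`f ∈ [0,1)²` — e.g. `r = |a₀₀| + |a₀₁| + |a₁₀| + |a₁₁|`.  If `r ≤ ρ` and a finite `T ⊆ ℤ²`
contains every `z` with `|A z + b − c| ≤ ρ`, then `π (ρ − r)² ≤ |det A| · #T`.
Proof: the parallelograms `A(z + [0,1)²) + b`, `z ∈ T` (area `|det A|` each), cover the disc of
radius `ρ − r` about `c`: for `y` in that disc, `z = ⌊A⁻¹(y − b)⌋` works.

This is the shadow-count device for the cell's `LatticeNoGain` (all facet normals `ν`): the bond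
lines of one direction meeting a tilted slab sample are indexed by an affine image of `ℤ²`.

WHAT THIS IS NOT: no upper bound; crude `O(ρ)` error.
-/

noncomputable section

namespace Summit.Ventures.Crystal3D

open MeasureTheory Set Finset

/-- **Affine disc count in `ℤ²`.** For a real `2 × 2` matrix `A` with `det A ≠ 0`, vectors
`b c : Fin 2 → ℝ`, a bound `r` with `‖A f‖₂ ≤ r` for all `f ∈ [0,1)²` (in the form
`(A f)₀² + (A f)₁² ≤ r²`), `0 ≤ r ≤ ρ`, and a finite `T ⊆ ℤ²` containing every `z` with
`((A z + b)₀ − c₀)² + ((A z + b)₁ − c₁)² ≤ ρ²`: `π (ρ − r)² ≤ |det A| · #T`. -/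
theorem affine_disc_count (A : Matrix (Fin 2) (Fin 2) ℝ) (hA : A.det ≠ 0) (b c : Fin 2 → ℝ)
    (r ρ : ℝ) (hr : 0 ≤ r) (hrρ : r ≤ ρ)
    (hbound : ∀ f : Fin 2 → ℝ, (∀ m, 0 ≤ f m ∧ f m < 1) →
      (A.mulVec f 0) ^ 2 + (A.mulVec f 1) ^ 2 ≤ r ^ 2)
    (T : Finset (ℤ × ℤ))
    (hT : ∀ i j : ℤ,
      (A.mulVec ![(i : ℝ), (j : ℝ)] 0 + b 0 - c 0) ^ 2 +
        (A.mulVec ![(i : ℝ), (j : ℝ)] 1 + b 1 - c 1) ^ 2 ≤ ρ ^ 2 → (i, j) ∈ T) :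
    Real.pi * (ρ - r) ^ 2 ≤ |A.det| * (T.card : ℝ) := by
  classical
  set M : (Fin 2 → ℝ) →ₗ[ℝ] (Fin 2 → ℝ) := Matrix.toLin' A with hM
  have hMapply : ∀ y, M y = A.mulVec y := fun y => by rw [hM, Matrix.toLin'_apply]
  have hdet : LinearMap.det M = A.det := by rw [hM, LinearMap.det_toLin']
  -- the inverse matrix
  have hAunit : IsUnit A.det := isUnit_iff_ne_zero.2 hA
  have hinv : ∀ y, A.mulVec (A⁻¹.mulVec y) = y := fun y => by
    rw [Matrix.mulVec_mulVec, Matrix.mul_nonsing_inv _ hAunit, Matrix.one_mulVec]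
  -- boxes and their images
  set Box : ℤ × ℤ → Set (Fin 2 → ℝ) := fun p =>
    Set.pi Set.univ fun m : Fin 2 =>
      Ico ((![(p.1 : ℝ), (p.2 : ℝ)] : Fin 2 → ℝ) m) ((![(p.1 : ℝ), (p.2 : ℝ)] : Fin 2 → ℝ) m + 1)
    with hBox
  have hBoxvol : ∀ p, volume (Box p) = 1 := by
    intro p; rw [hBox]; simp only; rw [Real.volume_pi_Ico]; simp
  set P : ℤ × ℤ → Set (Fin 2 → ℝ) := fun p => (fun y => y + b) '' (M '' Box p) with hP
  have hPvol : ∀ p, volume (P p) = ENNReal.ofReal |A.det| := by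
    intro p
    rw [hP]
    simp only
    rw [show (fun y : Fin 2 → ℝ => y + b) = fun y => b + y from funext fun y => add_comm y b,
      Set.image_add_left, measure_preimage_add, MeasureTheory.Measure.addHaar_image_linearMap,
      hdet, hBoxvol, mul_one]
  -- the disc of radius `ρ - r` about `c`
  set D : Set (Fin 2 → ℝ) :=
    (WithLp.toLp 2 : (Fin 2 → ℝ) → EuclideanSpace ℝ (Fin 2)) ⁻¹'
      Metric.ball (WithLp.toLp 2 c) (ρ - r) with hD
  have hDvol : volume D = ENNReal.ofReal (ρ - r) ^ 2 * ENNReal.ofReal Real.pi := by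
    rw [hD, (PiLp.volume_preserving_toLp (Fin 2)).measure_preimage
      measurableSet_ball.nullMeasurableSet, EuclideanSpace.volume_ball_fin_two]
  have hdist : ∀ u v : Fin 2 → ℝ,
      dist (WithLp.toLp 2 u : EuclideanSpace ℝ (Fin 2)) (WithLp.toLp 2 v) =
        Real.sqrt ((u 0 - v 0) ^ 2 + (u 1 - v 1) ^ 2) := by
    intro u v
    rw [EuclideanSpace.dist_eq, Fin.sum_univ_two]
    simp only [Real.dist_eq, sq_abs]
  -- covering
  have hcover : D ⊆ ⋃ p ∈ T, P p := by
    intro y hy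
    rw [hD, Set.mem_preimage, Metric.mem_ball] at hy
    -- lattice coordinates of `y`
    set s : Fin 2 → ℝ := A⁻¹.mulVec (y - b) with hs
    set i : ℤ := ⌊s 0⌋ with hi
    set j : ℤ := ⌊s 1⌋ with hj
    have hsi : (i : ℝ) ≤ s 0 ∧ s 0 < i + 1 := ⟨Int.floor_le _, Int.lt_floor_add_one _⟩
    have hsj : (j : ℝ) ≤ s 1 ∧ s 1 < j + 1 := ⟨Int.floor_le _, Int.lt_floor_add_one _⟩
    have hys : A.mulVec s + b = y := by rw [hs, hinv]; abel
    -- the fractional part and its image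
    set f : Fin 2 → ℝ := ![s 0 - i, s 1 - j] with hf
    have hfbox : ∀ m, 0 ≤ f m ∧ f m < 1 := by
      intro m; fin_cases m
      · simp [hf]; constructor <;> linarith [hsi.1, hsi.2]
      · simp [hf]; constructor <;> linarith [hsj.1, hsj.2]
    have hsdecomp : s = ![(i : ℝ), (j : ℝ)] + f := by
      funext m; fin_cases m <;> simp [hf]
    set q : Fin 2 → ℝ := A.mulVec ![(i : ℝ), (j : ℝ)] + b with hq
    have hqy : ∀ m, y m - q m = A.mulVec f m := by
      intro m
      have := congrFun hys m
      rw [hsdecomp, Matrix.mulVec_add] at this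
      simp only [Pi.add_apply] at this
      rw [hq]; simp only [Pi.add_apply]; linarith
    rw [Set.mem_iUnion₂]
    refine ⟨(i, j), ?_, ?_⟩
    · -- `(i, j) ∈ T`: the corner `q` is within `ρ` of `c`
      apply hT
      have hqc : dist (WithLp.toLp 2 q : EuclideanSpace ℝ (Fin 2)) (WithLp.toLp 2 c) ≤ ρ := by
        have hyq : dist (WithLp.toLp 2 y : EuclideanSpace ℝ (Fin 2)) (WithLp.toLp 2 q) ≤ r := by
          rw [hdist, hqy 0, hqy 1]
          calc Real.sqrt ((A.mulVec f 0) ^ 2 + (A.mulVec f 1) ^ 2) ≤ Real.sqrt (r ^ 2) :=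
                Real.sqrt_le_sqrt (hbound f hfbox)
            _ = r := Real.sqrt_sq hr
        have := dist_triangle (WithLp.toLp 2 q : EuclideanSpace ℝ (Fin 2)) (WithLp.toLp 2 y)
          (WithLp.toLp 2 c)
        rw [dist_comm] at hyq
        linarith
      rw [hdist] at hqc
      have h0 : 0 ≤ (q 0 - c 0) ^ 2 + (q 1 - c 1) ^ 2 := by positivity
      have hρ0 : 0 ≤ ρ := hr.trans hrρ
      have key : (q 0 - c 0) ^ 2 + (q 1 - c 1) ^ 2 ≤ ρ ^ 2 := by
        nlinarith [Real.sq_sqrt h0, Real.sqrt_nonneg ((q 0 - c 0) ^ 2 + (q 1 - c 1) ^ 2)]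
      simpa [hq] using key
    · -- `y ∈ P (i, j)`
      rw [hP]
      refine ⟨M (![(i : ℝ), (j : ℝ)] + f), ⟨![(i : ℝ), (j : ℝ)] + f, ?_, rfl⟩, ?_⟩
      · rw [hBox, Set.mem_pi]
        intro m _
        fin_cases m
        · simpa [hf] using hsi
        · simpa [hf] using hsj
      · rw [hMapply, ← hsdecomp]; exact hys
  -- measure comparison
  have hle : volume D ≤ (T.card : ENNReal) * ENNReal.ofReal |A.det| := by
    calc volume D ≤ volume (⋃ p ∈ T, P p) := measure_mono hcover
      _ ≤ ∑ p ∈ T, volume (P p) := measure_biUnion_finset_le T _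
      _ = ∑ p ∈ T, ENNReal.ofReal |A.det| := sum_congr rfl fun p _ => hPvol p
      _ = (T.card : ENNReal) * ENNReal.ofReal |A.det| := by rw [sum_const, nsmul_eq_mul]
  rw [hDvol] at hle
  have hρr : 0 ≤ ρ - r := by linarith
  have hle' : ENNReal.ofReal ((ρ - r) ^ 2 * Real.pi) ≤
      ENNReal.ofReal ((T.card : ℝ) * |A.det|) := by
    rw [ENNReal.ofReal_mul (sq_nonneg _), ENNReal.ofReal_pow hρr,
      ENNReal.ofReal_mul (Nat.cast_nonneg _), ENNReal.ofReal_natCast]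
    exact hle
  have hreal := (ENNReal.ofReal_le_ofReal_iff (by positivity)).1 hle'
  linarith

end Summit.Ventures.Crystal3D

end
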